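import Literature.NumberTheory.Rogawski1990.CartanInvariant
import Literature.NumberTheory.Automorphic.UnitaryGroupArchimedean
import HarnessLib

/-!
# An archimedean congruence of hermitian forms, read at each complex embedding

Topic `NumberTheory/Rogawski1990`; namespace `Literature.NumberTheory.Rogawski1990`; **THEOREMS ONLY** (no definition,
no named fact, no instance, no notation).  Cell `pub/hodgecm-mathlib`, road G6 «pre-stabilisation for the `U(3)` tori»
(crux H413 = `stmt-HodgeConjecture-24833`), item (G-c∞) of `CENSUS-R6R7-CartanObstruction`: the archimedean local condition
of Kottwitz's criterion [Rogawski1990, Prop. 3.3.1] in the currency the realisation step consumes.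
HC_CM is proved only modulo the printed citations until rung 0 closes.

THE MATHEMATICS.  Let `E ∕ F` be number fields with an `F`-automorphism `c ≠ 1` of `E` fixing every infinite place (so every
infinite place `w` of `E` is complex and `c ⊗ 1` is complex conjugation on the `w`-coordinate of `E ⊗_ℚ ℝ = ∏_w ℂ`; the CM
situation `F = L⁺`, `E = L`, `c` = complex conjugation).  For `J ∈ M_N(E)` write `J ⊗ 1 ∈ M_N(E ⊗ ℝ)` (★ `UnitaryGroup.archFormOf`)
and `H_g = ᵗ((c ⊗ 1) g) · (J ⊗ 1) · g` for the transported Gram matrix (★ `Rogawski1990.twistGram` over the ring `E ⊗ ℝ` with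
the involution ★ `UnitaryGroup.conjMixed`).  **If `ᵗ((c⊗1)g) (J ⊗ 1) g = K ⊗ 1` with `det g` a unit of `E ⊗ ℝ`, then at EVERY
ring map `ρ : E →+* ℂ` the complex matrices `ρ(J)`, `ρ(K)` are *congruent: `g′ᴴ ρ(J) g′ = ρ(K)` for some `g′ ∈ GL_N(ℂ)`** —
project to the complex place `w = mk ρ` (★ `UnitaryGroup.evalC`, ★ `evalC_conjMixed`, ★ `archFormOf_map_evalC`, functoriality
★ `twistGram_map`); if `w.embedding` is the conjugate of `ρ` rather than `ρ` itself, conjugate the congruence entrywise.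
This is the input `hloc` of ★ `Landherr.forall_card_pos_eigenvalues_map_eq_of_forall_congr{_units}` (Sylvester: congruent at every
embedding ⇒ equal positive indices) and hence of the `hsig` binder of ★ `Rogawski1990.exists_unitary_conj_inv_mul_twistGram_eq_of_invariants`
(realisation of a Cartan class): in the proof of [Rogawski1990, Prop. 3.3.1 (→)] for `G = U(H)`, the vanishing of the obstruction at
the archimedean places says exactly that `H · y ≅ H` over `L ⊗ ℝ`, and this file turns that into «the signatures of `H · y` and `H`
agree at every complex embedding».

* §1 `twistGram_starRingEnd` (`ℂ`: `twistGram conj A g = gᴴ A g`), `archFormOf_mul` (`(J·y) ⊗ 1 = (J ⊗ 1)(y ⊗ 1)`),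
  `twistGram_archFormOf_map_evalC` (the `w`-coordinate of `H_g` is `(g_w)ᴴ σ_w(J) g_w`);
* §2 `exists_gl_congr_map_embedding_of_twistGram_archFormOf_eq` (at a complex place), `exists_gl_congr_map_conjugate`
  (congruent at `φ` ⇒ congruent at `φ̄`), **`exists_gl_congr_map_of_twistGram_archFormOf_eq`** (at every `ρ : E →+* ℂ`; `GL` and
  `IsUnit det` editions, matrix or `GL_N(E ⊗ ℝ)` input);
* §3 the CM editions (`F = L⁺`, `c = complexConj L`, all side conditions discharged): **`exists_gl_congr_map_of_twistGram_arch_cm`** &c.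

## References
* [Rogawski1990] J. D. Rogawski, *Automorphic Representations of Unitary Groups in Three Variables*, Ann. of Math. Stud. 123 (1990),
  §3.3 Prop. 3.3.1 p. 22 (the local conditions at every place, in particular at `∞`), §3.5 Prop. 3.5.2 p. 29.
* [Landherr1936HermitianForms] W. Landherr, Abh. Math. Sem. Hamburg 11 (1936) 245–248 (signatures at the infinite places).
* [BorelJacquet1979] A. Borel, H. Jacquet, PSPM 33.1 (1979), §4.1 (`G(E ⊗ ℝ) = ∏_{w ∣ ∞} G(E_w)`).
-/

set_option autoImplicit false

noncomputable section

open NumberField NumberField.InfinitePlace NumberField.mixedEmbedding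
open scoped Matrix MatrixGroups ComplexConjugate

namespace Literature.NumberTheory.Rogawski1990

open Literature.NumberTheory.Automorphic
open Literature.NumberTheory.Automorphic.UnitaryGroup (archFormOf conjMixed evalC)

/-! ## §1. The `w`-coordinate of a transported Gram matrix -/

section Complex

variable {ι : Type} [Fintype ι]

/-- Over `ℂ` with complex conjugation the transported Gram matrix is the *congruence `gᴴ · A · g`.
[cite: Rogawski1990, §3.1 p. 19] -/
theorem twistGram_starRingEnd (A g : Matrix ι ι ℂ) : twistGram (starRingEnd ℂ) A g = gᴴ * A * g := by
  rw [twistGram_def]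
  rfl

variable [DecidableEq ι]

/-- **Congruent at `φ` ⇒ congruent at the conjugate embedding `φ̄`** (conjugate the congruence entrywise: `(ḡ)ᴴ ρ̄(J) ḡ = ρ̄(K)`).
[cite: Landherr1936HermitianForms] -/
theorem exists_gl_congr_map_conjugate {E : Type} [CommRing E] {J K : Matrix ι ι E} {φ : E →+* ℂ}
    (h : ∃ g : GL ι ℂ, (g : Matrix ι ι ℂ)ᴴ * J.map φ * (g : Matrix ι ι ℂ) = K.map φ) :
    ∃ g : GL ι ℂ, (g : Matrix ι ι ℂ)ᴴ * J.map ((starRingEnd ℂ).comp φ) * (g : Matrix ι ι ℂ) = K.map ((starRingEnd ℂ).comp φ) := by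
  obtain ⟨g, hg⟩ := h
  have hu : IsUnit ((g : Matrix ι ι ℂ).map (starRingEnd ℂ)).det := by
    rw [← RingHom.mapMatrix_apply, ← RingHom.map_det]
    exact (Matrix.isUnits_det_units g).map _
  refine ⟨Matrix.nonsingInvUnit _ hu, ?_⟩
  have hsemi : Function.Semiconj (starRingEnd ℂ) star star := fun x => by simp
  have e := congrArg (fun M : Matrix ι ι ℂ => M.map (starRingEnd ℂ)) hg
  simp only [Matrix.map_mul, Matrix.conjTranspose_map (starRingEnd ℂ) hsemi, Matrix.map_map] at e
  simpa [Matrix.nonsingInvUnit, RingHom.coe_comp] using e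

end Complex

section General

variable (F E : Type) [Field F] [Field E] [Algebra F E] (c : E ≃ₐ[F] E) (N : ℕ)

/-- `(J · y) ⊗ 1 = (J ⊗ 1) · (y ⊗ 1)` — `archFormOf` is multiplicative (an entrywise ring map). [cite: BorelJacquet1979, §4.1] -/
theorem archFormOf_mul (J y : Matrix (Fin N) (Fin N) E) : archFormOf E N (J * y) = archFormOf E N J * archFormOf E N y :=
  Matrix.map_mul

/-- **The `w`-coordinate of the transported Gram matrix.**  At a complex place `w` fixed by `c ≠ 1`,
`(ᵗ((c⊗1)g) (J⊗1) g)_w = (g_w)ᴴ · σ_w(J) · g_w`. [cite: Rogawski1990, §3.3 p. 21] [cite: BorelJacquet1979, §4.1] -/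
theorem twistGram_archFormOf_map_evalC (hc : c ≠ 1) {w : {w : InfinitePlace E // IsComplex w}} (hw : c • w.1 = w.1)
    (J : Matrix (Fin N) (Fin N) E) (g : Matrix (Fin N) (Fin N) (mixedSpace E)) :
    (twistGram (conjMixed F E c) (archFormOf E N J) g).map (evalC E w) =
      (g.map (evalC E w))ᴴ * J.map w.1.embedding * g.map (evalC E w) := by
  rw [twistGram_map (conjMixed F E c) (archFormOf E N J) (starRingEnd ℂ) (evalC E w)
      (fun r => UnitaryGroup.evalC_conjMixed F E c hw hc r) g,
    UnitaryGroup.archFormOf_map_evalC, twistGram_starRingEnd]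

/-! ## §2. From an archimedean congruence to a complex congruence at every embedding -/

/-- At a complex place `w` fixed by `c ≠ 1`: `ᵗ((c⊗1)g) (J⊗1) g = K ⊗ 1` with `det g` a unit gives `g′ᴴ σ_w(J) g′ = σ_w(K)`,
`g′ = g_w ∈ GL_N(ℂ)`. [cite: Rogawski1990, §3.3 Prop. 3.3.1 (local conditions at `∞`)] -/
theorem exists_gl_congr_map_embedding_of_twistGram_archFormOf_eq (hc : c ≠ 1) {w : {w : InfinitePlace E // IsComplex w}}
    (hw : c • w.1 = w.1) {J K : Matrix (Fin N) (Fin N) E} {g : Matrix (Fin N) (Fin N) (mixedSpace E)} (hg : IsUnit g.det)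
    (h : twistGram (conjMixed F E c) (archFormOf E N J) g = archFormOf E N K) :
    ∃ g' : GL (Fin N) ℂ, (g' : Matrix (Fin N) (Fin N) ℂ)ᴴ * J.map w.1.embedding * (g' : Matrix (Fin N) (Fin N) ℂ) =
      K.map w.1.embedding := by
  have hu : IsUnit (g.map (evalC E w)).det := by
    rw [← RingHom.mapMatrix_apply, ← RingHom.map_det]
    exact hg.map _
  refine ⟨Matrix.nonsingInvUnit _ hu, ?_⟩
  have e := congrArg (fun M : Matrix (Fin N) (Fin N) (mixedSpace E) => M.map (evalC E w)) h
  simp only [twistGram_archFormOf_map_evalC F E c N hc hw, UnitaryGroup.archFormOf_map_evalC] at e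
  exact e

/-- **ARCH TWIST ⇒ PER-EMBEDDING COMPLEX CONGRUENCE.**  Let `c ≠ 1` fix every infinite place of `E`.  If
`ᵗ((c⊗1)g) · (J ⊗ 1) · g = K ⊗ 1` over `E ⊗_ℚ ℝ` with `det g` a unit, then for EVERY ring map `ρ : E →+* ℂ` there is
`g′ ∈ GL_N(ℂ)` with `g′ᴴ · ρ(J) · g′ = ρ(K)` (the place `mk ρ` is complex; its embedding is `ρ` or `ρ̄`, and a congruence at `ρ̄`
conjugates to one at `ρ`).  This is the `hloc` input of ★ `Landherr.forall_card_pos_eigenvalues_map_eq_of_forall_congr_units`.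
[cite: Rogawski1990, §3.3 Prop. 3.3.1 (local conditions at `∞`), §3.5 Prop. 3.5.2] [cite: Landherr1936HermitianForms] -/
theorem exists_gl_congr_map_of_twistGram_archFormOf_eq (hc : c ≠ 1) (hfix : ∀ w : InfinitePlace E, c • w = w)
    {J K : Matrix (Fin N) (Fin N) E} {g : Matrix (Fin N) (Fin N) (mixedSpace E)} (hg : IsUnit g.det)
    (h : twistGram (conjMixed F E c) (archFormOf E N J) g = archFormOf E N K) (ρ : E →+* ℂ) :
    ∃ g' : GL (Fin N) ℂ, (g' : Matrix (Fin N) (Fin N) ℂ)ᴴ * J.map ρ * (g' : Matrix (Fin N) (Fin N) ℂ) = K.map ρ := by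
  have hwc : IsComplex (InfinitePlace.mk ρ) := UnitaryGroup.isComplex_of_smul_eq F E c hc (hfix _)
  have key : ∃ g' : GL (Fin N) ℂ, (g' : Matrix (Fin N) (Fin N) ℂ)ᴴ * J.map (InfinitePlace.mk ρ).embedding *
      (g' : Matrix (Fin N) (Fin N) ℂ) = K.map (InfinitePlace.mk ρ).embedding :=
    exists_gl_congr_map_embedding_of_twistGram_archFormOf_eq F E c N hc (w := ⟨InfinitePlace.mk ρ, hwc⟩) (hfix _) hg h
  rcases embedding_mk_eq ρ with hρ | hρ
  · rwa [hρ] at key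
  · -- `(mk ρ).embedding = ρ̄`: conjugate the congruence
    have key' := exists_gl_congr_map_conjugate (φ := (InfinitePlace.mk ρ).embedding) key
    have hcomp : (starRingEnd ℂ).comp (InfinitePlace.mk ρ).embedding = ρ := by
      rw [hρ]
      ext x
      simp [ComplexEmbedding.conjugate_coe_eq]
    rwa [hcomp] at key'

/-- The same with a `GL_N(E ⊗ ℝ)` conjugator. [cite: Rogawski1990, §3.3 Prop. 3.3.1 (local conditions at `∞`)] -/
theorem exists_gl_congr_map_of_twistGram_archFormOf_eq_units (hc : c ≠ 1) (hfix : ∀ w : InfinitePlace E, c • w = w)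
    {J K : Matrix (Fin N) (Fin N) E} (g : GL (Fin N) (mixedSpace E))
    (h : twistGram (conjMixed F E c) (archFormOf E N J) (g : Matrix (Fin N) (Fin N) (mixedSpace E)) = archFormOf E N K)
    (ρ : E →+* ℂ) :
    ∃ g' : GL (Fin N) ℂ, (g' : Matrix (Fin N) (Fin N) ℂ)ᴴ * J.map ρ * (g' : Matrix (Fin N) (Fin N) ℂ) = K.map ρ :=
  exists_gl_congr_map_of_twistGram_archFormOf_eq F E c N hc hfix (Matrix.isUnits_det_units g) h ρ

/-- `IsUnit det` edition of the conclusion (the `hloc` shape of ★ `Landherr.forall_card_pos_eigenvalues_map_eq_of_forall_congr`).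
[cite: Rogawski1990, §3.3 Prop. 3.3.1 (local conditions at `∞`)] -/
theorem exists_isUnit_congr_map_of_twistGram_archFormOf_eq (hc : c ≠ 1) (hfix : ∀ w : InfinitePlace E, c • w = w)
    {J K : Matrix (Fin N) (Fin N) E} {g : Matrix (Fin N) (Fin N) (mixedSpace E)} (hg : IsUnit g.det)
    (h : twistGram (conjMixed F E c) (archFormOf E N J) g = archFormOf E N K) (ρ : E →+* ℂ) :
    ∃ g' : Matrix (Fin N) (Fin N) ℂ, IsUnit g'.det ∧ g'ᴴ * J.map ρ * g' = K.map ρ := by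
  obtain ⟨g', hg'⟩ := exists_gl_congr_map_of_twistGram_archFormOf_eq F E c N hc hfix hg h ρ
  exact ⟨g', Matrix.isUnits_det_units g', hg'⟩

end General

/-! ## §3. The CM case: `F = L⁺`, `c` = complex conjugation (fixes every infinite place, `≠ 1`) -/

section CM

variable (L : Type) [Field L] [NumberField L] [IsCMField L] (N : ℕ)

/-- **CM edition.**  For a CM field `L`: if `ᵗ(ḡ) · (H ⊗ 1) · g = K ⊗ 1` over `L ⊗_ℚ ℝ` (`ḡ = (complexConj ⊗ 1) g`,
`det g` a unit) then at every `ρ : L →+* ℂ` there is `g′ ∈ GL_N(ℂ)` with `g′ᴴ ρ(H) g′ = ρ(K)`.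
[cite: Rogawski1990, §3.3 Prop. 3.3.1 (local conditions at `∞`), §3.5 Prop. 3.5.2] [cite: Landherr1936HermitianForms] -/
theorem exists_gl_congr_map_of_twistGram_arch_cm {H K : Matrix (Fin N) (Fin N) L} {g : Matrix (Fin N) (Fin N) (mixedSpace L)}
    (hg : IsUnit g.det)
    (h : twistGram (conjMixed (↥(maximalRealSubfield L)) L (IsCMField.complexConj L)) (archFormOf L N H) g = archFormOf L N K)
    (ρ : L →+* ℂ) :
    ∃ g' : GL (Fin N) ℂ, (g' : Matrix (Fin N) (Fin N) ℂ)ᴴ * H.map ρ * (g' : Matrix (Fin N) (Fin N) ℂ) = K.map ρ :=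
  exists_gl_congr_map_of_twistGram_archFormOf_eq (↥(maximalRealSubfield L)) L (IsCMField.complexConj L) N
    (IsCMField.complexConj_ne_one L) (UnitaryGroup.complexConj_smul_infinitePlace L) hg h ρ

/-- CM edition, `GL_N(L ⊗ ℝ)` conjugator. [cite: Rogawski1990, §3.3 Prop. 3.3.1 (local conditions at `∞`)] -/
theorem exists_gl_congr_map_of_twistGram_arch_cm_units {H K : Matrix (Fin N) (Fin N) L} (g : GL (Fin N) (mixedSpace L))
    (h : twistGram (conjMixed (↥(maximalRealSubfield L)) L (IsCMField.complexConj L)) (archFormOf L N H)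
      (g : Matrix (Fin N) (Fin N) (mixedSpace L)) = archFormOf L N K)
    (ρ : L →+* ℂ) :
    ∃ g' : GL (Fin N) ℂ, (g' : Matrix (Fin N) (Fin N) ℂ)ᴴ * H.map ρ * (g' : Matrix (Fin N) (Fin N) ℂ) = K.map ρ :=
  exists_gl_congr_map_of_twistGram_arch_cm L N (Matrix.isUnits_det_units g) h ρ

/-- CM edition, `IsUnit det` conclusion (the `hloc` shape of ★ `Landherr.forall_card_pos_eigenvalues_map_eq_of_forall_congr`, hence
of the `hsig` binder of ★ `exists_unitary_conj_inv_mul_twistGram_eq_of_invariants` at `K := H * y`).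
[cite: Rogawski1990, §3.3 Prop. 3.3.1 (local conditions at `∞`), §3.5 Prop. 3.5.2] -/
theorem exists_isUnit_congr_map_of_twistGram_arch_cm {H K : Matrix (Fin N) (Fin N) L} {g : Matrix (Fin N) (Fin N) (mixedSpace L)}
    (hg : IsUnit g.det)
    (h : twistGram (conjMixed (↥(maximalRealSubfield L)) L (IsCMField.complexConj L)) (archFormOf L N H) g = archFormOf L N K) :
    ∀ ρ : L →+* ℂ, ∃ g' : Matrix (Fin N) (Fin N) ℂ, IsUnit g'.det ∧ g'ᴴ * H.map ρ * g' = K.map ρ :=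
  fun ρ => exists_isUnit_congr_map_of_twistGram_archFormOf_eq (↥(maximalRealSubfield L)) L (IsCMField.complexConj L) N
    (IsCMField.complexConj_ne_one L) (UnitaryGroup.complexConj_smul_infinitePlace L) hg h ρ

/-- CM edition with the target written as `(H ⊗ 1) · (y ⊗ 1)` (a Cartan class `y`): congruence at every `ρ` between `ρ(H)` and
`ρ(H · y)`. [cite: Rogawski1990, §3.5 Prop. 3.5.2 p. 29] -/
theorem exists_gl_congr_map_mul_of_twistGram_arch_cm {H y : Matrix (Fin N) (Fin N) L} {g : Matrix (Fin N) (Fin N) (mixedSpace L)}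
    (hg : IsUnit g.det)
    (h : twistGram (conjMixed (↥(maximalRealSubfield L)) L (IsCMField.complexConj L)) (archFormOf L N H) g =
      archFormOf L N H * archFormOf L N y) (ρ : L →+* ℂ) :
    ∃ g' : GL (Fin N) ℂ, (g' : Matrix (Fin N) (Fin N) ℂ)ᴴ * H.map ρ * (g' : Matrix (Fin N) (Fin N) ℂ) = (H * y).map ρ :=
  exists_gl_congr_map_of_twistGram_arch_cm L N hg (by rw [h, archFormOf_mul]) ρ

end CM

end Literature.NumberTheory.Rogawski1990

end
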